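import Literature.MathematicalPhysics.QuantumFieldTheory.Balaban1983to89.B4Lower18Regular

/-!
# `Balaban1983to89.B4Prop31Prism` — T. Bałaban, *Regularity and decay of lattice Green's functions*, Commun. Math.
Phys. **89** (1983) 571–597 [Balaban1983RegularityDecay] (= [B4]): «Proposition 3.1′ of [2]» (1.21)–(1.22) p. 574 at
`A ≠ 0` — file 2a/3: ABELIAN TELESCOPING along a straight contour and the PRISM INEQUALITY for [B4]'s one-parameter
orthogonal link variables `U(A_b) = exp(qeηA_b)` (1.2) (`B4GaugeCovariance.OrthFlow`)

statement-level skeleton of published theorems with citation tags; proofs where landed; nothing here is a claim about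
the Yang–Mills mass gap

PDF held: `paper:balaban1983-cmp89-regularity-decay` (journal page = PDF page + 570); pp. 572, 590 [PDF 2, 20] read.

CITATION HEADER (lean-in-tree rule).  Phase-2 PROOF file of the lit-balaban typed skeleton (HOME
`run/shared/lean/pub/lit-balaban/`), SKELETON row **`B4.Prop3.1'[II]`** (owner r01, referee ref-4), seat p35 gen 2 (unit
`lit-balaban-p35`); companions `B4Prop31Energy` (file 1), `B4Prop31Holonomy` (file 2b), `B4Prop31Averaging` /
`B4Prop31Regular` (file 3).  GENERIC in the colour type `ι` and the flow; no lattice here.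

THE PRINTED TEXT it serves (p. 590 [PDF 20]): the two-block inequality (4.7) *"a_k|φ(x)|² + a_k|φ(x′)|² − a_k²⟨φ,
Q_k(A)G_k(Δ(x,x′),A)Q_k^*(A)φ⟩ ≥ γ₀′|U(A(⟨x,x′⟩))φ(x′) − φ(x)|² − O(1)e²p²(e)(|φ(x)|² + |φ(x′)|²)"* — whose mechanism
is the comparison of `U(A(⟨x,x′⟩))·(Q_k(A)φ′)(x′)` with `(Q_k(A)φ′)(x)` point by point along the prisms
`Γ_{x,z} ∪ [z, z′] ∪ Γ_{x′,z′} ∪ ⟨x′,x⟩`, `z ∈ B^k(x)` (the contours of (4.8)).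

WHAT IS KERNEL-CHECKED (zero `sorry`, standard axioms; no new `Prop`-valued statement): `flow_telescope` (the covariant
telescoping `U(Σα)v_m − v_0 = Σ U(Σ_{<i}α)(U(α_i)v_{i+1} − v_i)`), `flow_telescope_sq_le` (Cauchy–Schwarz with
orthogonal prefixes), **`prism_sq_le`**: `|U(κτ)U(κσ′)v_n − U(κσ)v_0|² ≤ 2(ℓκΛ)²|v_n|² + 2n·Σ_{i<n}|U(κα_i)v_{i+1} − v_i|²`
with the holonomy `Λ = τ + σ′ − σ − Σα_i`, for any flow with `|(U(t) − 1)v|² ≤ (ℓt)²|v|²`.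
Unit `lit-balaban-p35` (gen 2), HOME as above.
-/

namespace Literature.MathematicalPhysics.QuantumFieldTheory.Balaban1983to89.B4Prop31Prism

open Matrix Finset
open Literature.MathematicalPhysics.QuantumFieldTheory.Balaban1983to89.B4GaugeCovariance
open Literature.MathematicalPhysics.QuantumFieldTheory.Balaban1983to89.B4Lower18Regular
  (dotProduct_self_nonneg' orth_dotProduct_mulVec_self sum_smul_dotProduct_self_le)

noncomputable section

section Flow

/-! ## §3 (stated first, used last)  Abelian telescoping along a straight contour and the prism inequality -/

variable {ι : Type*} [Fintype ι] [DecidableEq ι]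

/-- **TELESCOPING OF TRANSPORTS ALONG A CONTOUR** for a one-parameter flow: `U(Σ_{i<m}α_i)v_m − v_0 =
Σ_{i<m} U(Σ_{t<i}α_t)·(U(α_i)v_{i+1} − v_i)` (the covariant form of `φ(x′) − φ(x) = Σ (D^η_Aφ)(b)·η` along
`[x, x′]`, [B4] p. 572 (1.3)). [cite: Balaban1983RegularityDecay, p. 572 (1.3), telescoping] -/
theorem flow_telescope (F : OrthFlow ι) (α : ℕ → ℝ) (v : ℕ → ι → ℝ) (m : ℕ) :
    F.U (∑ i ∈ range m, α i) *ᵥ v m - v 0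
      = ∑ i ∈ range m, F.U (∑ t ∈ range i, α t) *ᵥ (F.U (α i) *ᵥ v (i + 1) - v i) := by
  induction m with
  | zero => simp [F.map_zero]
  | succ m ih =>
      rw [Finset.sum_range_succ, Finset.sum_range_succ, ← ih, F.map_add, ← Matrix.mulVec_mulVec, Matrix.mulVec_sub,
        Matrix.mulVec_mulVec]
      abel

/-- Cauchy–Schwarz for the telescoped sum: `|U(Σα)v_m − v_0|² ≤ m·Σ_{i<m}|U(α_i)v_{i+1} − v_i|²` (the prefix
transporters are orthogonal). [cite: Balaban1983RegularityDecay, p. 572 (1.3), telescoping] -/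
theorem flow_telescope_sq_le (F : OrthFlow ι) (α : ℕ → ℝ) (v : ℕ → ι → ℝ) (m : ℕ) :
    (F.U (∑ i ∈ range m, α i) *ᵥ v m - v 0) ⬝ᵥ (F.U (∑ i ∈ range m, α i) *ᵥ v m - v 0)
      ≤ m * ∑ i ∈ range m, (F.U (α i) *ᵥ v (i + 1) - v i) ⬝ᵥ (F.U (α i) *ᵥ v (i + 1) - v i) := by
  rw [flow_telescope]
  set w : ℕ → ι → ℝ := fun i => F.U (∑ t ∈ range i, α t) *ᵥ (F.U (α i) *ᵥ v (i + 1) - v i) with hw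
  have hcs := sum_smul_dotProduct_self_le (ι := ι) (range m) (q := fun _ => (1 : ℝ)) (fun _ => zero_le_one) w
  simp only [one_smul, one_mul, Finset.sum_const, Finset.card_range, nsmul_eq_mul, mul_one] at hcs
  have horth : ∀ i, w i ⬝ᵥ w i = (F.U (α i) *ᵥ v (i + 1) - v i) ⬝ᵥ (F.U (α i) *ᵥ v (i + 1) - v i) := by
    intro i
    rw [hw]
    exact orth_dotProduct_mulVec_self (F.orth _) _
  simp only [horth] at hcs
  exact hcs

omit [DecidableEq ι] in
/-- `|u + w|² ≤ 2|u|² + 2|w|²`. [folklore] -/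
private theorem add_sq_le_two (u w : ι → ℝ) : (u + w) ⬝ᵥ (u + w) ≤ 2 * (u ⬝ᵥ u) + 2 * (w ⬝ᵥ w) := by
  have h0 := dotProduct_self_nonneg' (u - w)
  have : (u + w) ⬝ᵥ (u + w) + (u - w) ⬝ᵥ (u - w) = 2 * (u ⬝ᵥ u) + 2 * (w ⬝ᵥ w) := by
    simp only [add_dotProduct, dotProduct_add, sub_dotProduct, dotProduct_sub, dotProduct_comm w u]
    ring
  linarith

/-- **THE PRISM INEQUALITY** (the covariant comparison of the two transported averages across a unit bond, cf. the
contours of (4.8)–(4.10)): for reals `τ, σ′, σ` and `α_0,…,α_{n−1}` with HOLONOMY `Λ = τ + σ′ − σ − Σ_{i<n}α_i`, a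
Lipschitz orthogonal flow (`|(U(t) − 1)v|² ≤ (ℓt)²|v|²`) and vectors `v_0,…,v_n`:
`|U(κτ)U(κσ′)v_n − U(κσ)v_0|² ≤ 2(ℓκΛ)²|v_n|² + 2n·Σ_{i<n}|U(κα_i)v_{i+1} − v_i|²`.
[cite: Balaban1983RegularityDecay, p. 590 (4.7)–(4.10), mechanism] -/
theorem prism_sq_le (F : OrthFlow ι) {ℓ : ℝ}
    (hLip : ∀ t (v : ι → ℝ), ((F.U t - 1) *ᵥ v) ⬝ᵥ ((F.U t - 1) *ᵥ v) ≤ (ℓ * t) ^ 2 * (v ⬝ᵥ v))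
    (κ τ σ' σ : ℝ) (α : ℕ → ℝ) (v : ℕ → ι → ℝ) (n : ℕ) :
    (F.U (κ * τ) *ᵥ (F.U (κ * σ') *ᵥ v n) - F.U (κ * σ) *ᵥ v 0) ⬝ᵥ
        (F.U (κ * τ) *ᵥ (F.U (κ * σ') *ᵥ v n) - F.U (κ * σ) *ᵥ v 0)
      ≤ 2 * (ℓ * (κ * (τ + σ' - σ - ∑ i ∈ range n, α i))) ^ 2 * (v n ⬝ᵥ v n)
        + 2 * (n * ∑ i ∈ range n,
            (F.U (κ * α i) *ᵥ v (i + 1) - v i) ⬝ᵥ (F.U (κ * α i) *ᵥ v (i + 1) - v i)) := by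
  set Λ : ℝ := τ + σ' - σ - ∑ i ∈ range n, α i with hΛ
  set π : ℝ := ∑ i ∈ range n, κ * α i with hπ
  -- the two transported vectors, pulled back by `U(κσ)`
  set u : ι → ℝ := F.U π *ᵥ ((F.U (κ * Λ) - 1) *ᵥ v n) with hu
  set w : ι → ℝ := F.U π *ᵥ v n - v 0 with hw'
  have hsum : κ * τ + κ * σ' = κ * σ + (π + κ * Λ) := by
    rw [hπ, hΛ, ← Finset.mul_sum]
    ring
  have huw : u + w = F.U π *ᵥ (F.U (κ * Λ) *ᵥ v n) - v 0 := by
    rw [hu, hw', Matrix.sub_mulVec, Matrix.one_mulVec, Matrix.mulVec_sub]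
    abel
  have hkey : F.U (κ * τ) *ᵥ (F.U (κ * σ') *ᵥ v n) - F.U (κ * σ) *ᵥ v 0 = F.U (κ * σ) *ᵥ (u + w) := by
    rw [huw, Matrix.mulVec_sub]
    simp only [Matrix.mulVec_mulVec, ← F.map_add]
    rw [hsum]
  rw [hkey, orth_dotProduct_mulVec_self (F.orth _)]
  refine (add_sq_le_two u w).trans ?_
  have h1 : u ⬝ᵥ u ≤ (ℓ * (κ * Λ)) ^ 2 * (v n ⬝ᵥ v n) := by
    rw [hu, orth_dotProduct_mulVec_self (F.orth _)]
    exact hLip _ _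
  have h2 : w ⬝ᵥ w ≤ n * ∑ i ∈ range n,
      (F.U (κ * α i) *ᵥ v (i + 1) - v i) ⬝ᵥ (F.U (κ * α i) *ᵥ v (i + 1) - v i) := by
    rw [hw', hπ]
    exact flow_telescope_sq_le F (fun i => κ * α i) v n
  linarith

end Flow

end

end Literature.MathematicalPhysics.QuantumFieldTheory.Balaban1983to89.B4Prop31Prism
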